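import Summits.Parity.GeneralizedHardyLittlewood.Theorems.LeeYangFibresCellParityLawSavingVariantDefs
import Summits.Parity.GeneralizedHardyLittlewood.Theorems.LeeYangFibresCellParityLawSavingHypAlong
import Summits.Parity.GeneralizedHardyLittlewood.Theorems.LeeYangFibresCellParityLawSavingWalshStep
import HarnessLib

/-!
# Route `LeeYangFibres`, crux `CellParityLawSaving` (stmt-Parity-18104), line `superpoly-band-same-atom`
# (payload slug `SketchIdeator3`), VARIANT B: the registered stub `stub_hypGS` — the kernel's hypotheses
# for the localised section sequence along the schedule, with the Granville–Soundararajan-adjacent deficit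

We prove the registered stub `stub_hypGS : HypGS` of the Variant-B vocabulary
(`LeeYangFibresCellParityLawSavingVariantDefs`):

  `SectionSeqBFacts → SectionSeqBCells → SectionDimension → SectionDimensionLow →
     ∀ c ≥ 2, (∀ t ≥ 1, SectionLevelGSAt c t) → ∀ t ≥ 1, KernelReadyGSAt c t`,

i.e. that for `N ≥ N₀(c, t, L, A)` the Bombieri-normalised section sequence `𝒜 = secSeqB Ψ K N U i j'` at the
scheduled roughness `U = U(N) = slowDegree N` — of a non-degenerate system of size `≤ L`, a convex body
`K ⊆ [-N,N]` localised to `ψ_i > x/Λ`, a coordinate with no degenerate prime and frozen cells `j' ∈ [1,U]^t` —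
with the parameters `x = 2LN`, `z = N^{1/U}`, `Λ = (log N)^{t+2}`, `w₀ = (log N)²`, `R = N/(log N)^A`,
`A₁ = t + 2`, `L' = max(L'_{dim}, L₁)` and the VARIANT-B level deficit `η = etaGS N c = 2(log N)^{-1/c}`
satisfies every hypothesis of the kernel VERBATIM (the statement `KernelReadyGSAt c t`).

How. This is the landed `stub_hypAlong` (`LeeYangFibresCellParityLawSavingHypAlong`, deficit
`2(log log N)^{-B₂}`) with the deficit replaced by `2(log N)^{-1/c}`. Everything `η`-free is consumed by name
(`HypAlongAux.eventually_range_z_lower_along`, `eventually_size_lower_along`, `eventually_sqrt_loglog_along`,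
`GeThreeHypAux.range_z_upper`, `hasIwaniecDimension_mono`, the `secSeqB` identities, the value bound `≤ 2LN` of
`stub_prLawTwoPrep`, the two dimension bounds), and the atom `SectionLevelGSAt c t` is applied at `u := U(N)` to the
convex bodies `K ∩ {ψ_i ≤ y}` (level `N^{1-(log N)^{-1/c}}`, saving `(log N)^{-A}`). The four `η`-DEPENDENT facts
are redone (`ℓ = log N`, `ε = ℓ^{-1/c}`, `η = 2ε`, `c ≥ 2`, so `ℓ^{1/c} ≤ ℓ^{1/2}`):
* `(log 2LN)^{-1/2} ≤ ℓ^{-1/2} ≤ ℓ^{-1/c} ≤ 2ℓ^{-1/c}` (`HypGSAux.eventually_range_etaGS_lower`);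
* `8U ≤ 4U² ≤ log log N ≤ ℓ^{1/c}` along the schedule, whence `2ℓ^{-1/c} ≤ 1/(4U)`
  (`HypGSAux.eventually_range_etaGS_upper_along`, from `quantClip_schedule` and `WalshStepSavAux.exists_thresholds`);
* `k log ℓ · ℓ^{1/c} ≤ ℓ^{1/4} ℓ^{1/4} ℓ^{1/2} = ℓ`, whence `(log N)^k = e^{k log ℓ} ≤ e^{ηℓ} = N^η ≤ (2LN)^η`
  (`HypGSAux.eventually_logpow_le_xpow_etaGS`);
* `log 2L · ℓ^{1/c} ≤ ℓ^{1/2} ℓ^{1/2} = ℓ`, i.e. `log 2L ≤ εℓ`, whence `(2LN)^{1-2ε} ≤ N^{1-ε}` and the kernel's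
  level `x^{1-η}` is below the atom's level (`HypGSAux.eventually_levelGS_le`).

References: E. Bombieri, Rend. Accad. Naz. XL (5) 1/2 (1975/76) [BombieriAsymptoticSieve1976]; RIMS Kôkyûroku
294 (1977) p. 5 [BombieriRIMS1977]; J. Friedlander, H. Iwaniec, Ann. Sc. Norm. Sup. Pisa (4) 5 (1978) §4
[FriedlanderIwaniecPisa1978]; A. Granville, K. Soundararajan, Ann. of Math. 165 (2007) [GranvilleSoundararajan2007]
for the level scale `N e^{-(log N)^{1-1/c}}`. No named fact is used: everything is composed from landed tree theorems.
-/

noncomputable section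

open scoped BigOperators Classical
open Finset Filter Literature.NumberTheory.Sieve
open Summit.Parity.GeneralizedHardyLittlewood.Cruxes.CellParityLaw.SectionAnnihilator
open Summit.Parity.GeneralizedHardyLittlewood.Cruxes.AbsoluteUpgrade.DipMarginRateExchange (slowDegree
  four_le_slowDegree quantClip_schedule)

namespace Summit.Parity.GeneralizedHardyLittlewood.Cruxes.CellParityLawSaving.SuperPolyBand

namespace HypGSAux

/-! ## The four `η`-dependent range/level facts for `η = 2(log N)^{-1/c}` -/

/-- `ℓ^{1/c} ≤ ℓ^{1/2}` for `ℓ ≥ 1` and `c ≥ 2`. -/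
theorem rpow_inv_le_sqrt {ℓ : ℝ} {c : ℕ} (hℓ : 1 ≤ ℓ) (hc : 2 ≤ c) :
    ℓ ^ (1 / (c : ℝ)) ≤ ℓ ^ (1 / 2 : ℝ) := by
  have hc2 : (2 : ℝ) ≤ c := by exact_mod_cast hc
  exact Real.rpow_le_rpow_of_exponent_le hℓ (one_div_le_one_div_of_le (by norm_num) hc2)

/-- Eventually `(log (2LN))^{-1/2} ≤ 2/(log N)^{1/c}` (`L ≥ 1`, `c ≥ 2`):
`(log 2LN)^{-1/2} ≤ ℓ^{-1/2} ≤ ℓ^{-1/c} ≤ 2ℓ^{-1/c}`, `ℓ = log N ≥ 1`. -/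
theorem eventually_range_etaGS_lower (L c : ℕ) (hL : 1 ≤ L) (hc : 2 ≤ c) :
    ∀ᶠ N : ℕ in atTop, Real.log (2 * (L : ℝ) * N) ^ (-(1 / 2 : ℝ)) ≤
      2 / Real.log (N : ℝ) ^ (1 / (c : ℝ)) := by
  have hL1 : (1 : ℝ) ≤ L := by exact_mod_cast hL
  filter_upwards [(Real.tendsto_log_atTop.comp tendsto_natCast_atTop_atTop).eventually_ge_atTop (1 : ℝ),
    eventually_ge_atTop 1] with N hℓ1 hN1
  have hN0 : (0 : ℝ) < N := by exact_mod_cast (by omega : 0 < N)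
  have hℓ1' : 1 ≤ Real.log (N : ℝ) := hℓ1
  set ℓ := Real.log (N : ℝ) with hℓ
  have hℓ0 : 0 < ℓ := by linarith
  -- `log (2LN) ≥ ℓ`, exponent negative
  have hlogx : ℓ ≤ Real.log (2 * (L : ℝ) * N) := by
    rw [hℓ]; exact Real.log_le_log hN0 (by nlinarith)
  have hroot : ℓ ^ (1 / (c : ℝ)) ≤ ℓ ^ (1 / 2 : ℝ) := rpow_inv_le_sqrt hℓ1' hc
  have hpow0 : 0 < ℓ ^ (1 / (c : ℝ)) := Real.rpow_pos_of_pos hℓ0 _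
  calc Real.log (2 * (L : ℝ) * N) ^ (-(1 / 2 : ℝ)) ≤ ℓ ^ (-(1 / 2 : ℝ)) :=
        Real.rpow_le_rpow_of_nonpos hℓ0 hlogx (by norm_num)
    _ = (ℓ ^ (1 / 2 : ℝ))⁻¹ := by rw [Real.rpow_neg hℓ0.le]
    _ ≤ (ℓ ^ (1 / (c : ℝ)))⁻¹ := inv_anti₀ hpow0 hroot
    _ = 1 / ℓ ^ (1 / (c : ℝ)) := (one_div _).symm
    _ ≤ 2 / ℓ ^ (1 / (c : ℝ)) := by gcongr; norm_num

/-- Eventually along the schedule `2/(log N)^{1/c} ≤ 1/(4U)`, `U = U(N)` (`c ≥ 1`):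
`8U ≤ 4U² ≤ log log N ≤ (log N)^{1/c}` (`HypAlongAux.schedule_pointwise`, `WalshStepSavAux.exists_thresholds`). -/
theorem eventually_range_etaGS_upper_along (c : ℕ) (hc : 1 ≤ c) :
    ∀ᶠ N : ℕ in atTop, 2 / Real.log (N : ℝ) ^ (1 / (c : ℝ)) ≤ 1 / (4 * (slowDegree N : ℝ)) := by
  have hc0 : (0 : ℝ) < c := by exact_mod_cast hc
  have hc1 : (0 : ℝ) < 1 / (c : ℝ) := by positivity
  obtain ⟨N₁, hN₁⟩ := WalshStepSavAux.exists_thresholds hc1 hc1 1 0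
  filter_upwards [HypAlongAux.eventually_schedule 0, eventually_ge_atTop N₁] with N hN hNN₁
  obtain ⟨-, hN16, hexpU, -⟩ := hN
  have hU4 := four_le_slowDegree N
  obtain ⟨-, hll4, -⟩ := HypAlongAux.schedule_pointwise hU4 hN16 hexpU
  obtain ⟨-, hll, -⟩ := hN₁ N hNN₁
  rw [pow_one] at hll
  have hU4R : (4 : ℝ) ≤ slowDegree N := by exact_mod_cast hU4
  have h8 : 8 * (slowDegree N : ℝ) ≤ 4 * (slowDegree N : ℝ) ^ 2 := by nlinarith
  have hpos : 0 < Real.log (N : ℝ) ^ (1 / (c : ℝ)) := by linarith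
  rw [div_le_div_iff₀ hpos (by positivity)]
  linarith

/-- Eventually `(log N)^k ≤ (2LN)^{2/(log N)^{1/c}}` (`L ≥ 1`, `c ≥ 2`): `(2LN)^η ≥ N^η = e^{ηℓ}`,
`(log N)^k = e^{k log ℓ}` and `k log ℓ · ℓ^{1/c} ≤ ℓ^{1/4} ℓ^{1/4} ℓ^{1/2} = ℓ ≤ 2ℓ` once `log ℓ, k ≤ ℓ^{1/4}`
(the algebra of `GeThreeHypAux.eventually_logpow_le_xpow_eta`). -/
theorem eventually_logpow_le_xpow_etaGS (L c k : ℕ) (hL : 1 ≤ L) (hc : 2 ≤ c) :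
    ∀ᶠ N : ℕ in atTop, Real.log (N : ℝ) ^ k ≤
      (2 * (L : ℝ) * N) ^ (2 / Real.log (N : ℝ) ^ (1 / (c : ℝ))) := by
  have hL1 : (1 : ℝ) ≤ L := by exact_mod_cast hL
  obtain ⟨N₁, hN₁⟩ := WalshStepSavAux.exists_thresholds (show (0 : ℝ) < 1 / 4 by norm_num)
    (show (0 : ℝ) < 1 / 4 by norm_num) 1 (k : ℝ)
  filter_upwards [eventually_ge_atTop N₁, eventually_ge_atTop 1] with N hNN₁ hN1
  obtain ⟨hℓ1, hll, hk⟩ := hN₁ N hNN₁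
  have hN0 : (0 : ℝ) < N := by exact_mod_cast (by omega : 0 < N)
  set ℓ := Real.log (N : ℝ) with hℓ
  set ℓℓ := Real.log ℓ with hℓℓ
  rw [pow_one] at hll
  have hℓ0 : 0 < ℓ := by linarith
  have hℓℓ0 : 0 ≤ ℓℓ := Real.log_nonneg hℓ1.le
  set η : ℝ := 2 / ℓ ^ (1 / (c : ℝ)) with hη
  have hpow0 : 0 < ℓ ^ (1 / (c : ℝ)) := Real.rpow_pos_of_pos hℓ0 _
  have hη0 : 0 < η := by rw [hη]; positivity
  -- `k ℓℓ ≤ η ℓ`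
  have hkey : (k : ℝ) * ℓℓ ≤ η * ℓ := by
    rw [hη, div_mul_eq_mul_div, le_div_iff₀ hpow0]
    have hA : (k : ℝ) * ℓℓ ≤ ℓ ^ (1 / 4 : ℝ) * ℓ ^ (1 / 4 : ℝ) :=
      mul_le_mul hk hll hℓℓ0 (Real.rpow_nonneg hℓ0.le _)
    have hB : ℓ ^ (1 / (c : ℝ)) ≤ ℓ ^ (1 / 2 : ℝ) := rpow_inv_le_sqrt hℓ1.le hc
    calc (k : ℝ) * ℓℓ * ℓ ^ (1 / (c : ℝ)) ≤ ℓ ^ (1 / 4 : ℝ) * ℓ ^ (1 / 4 : ℝ) * ℓ ^ (1 / 2 : ℝ) :=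
          mul_le_mul hA hB hpow0.le (by positivity)
      _ = ℓ := by
          rw [← Real.rpow_add hℓ0, ← Real.rpow_add hℓ0]
          norm_num
      _ ≤ 2 * ℓ := by linarith
  -- `(log N)^k = exp (k ℓℓ) ≤ exp (η ℓ) = N^η ≤ (2LN)^η`
  have h1 : ℓ ^ k = Real.exp ((k : ℝ) * ℓℓ) := by
    rw [← Real.rpow_natCast ℓ k, Real.rpow_def_of_pos hℓ0, mul_comm, hℓℓ]
  have h2 : (N : ℝ) ^ η = Real.exp (η * ℓ) := by
    rw [Real.rpow_def_of_pos hN0, hℓ, mul_comm]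
  calc ℓ ^ k = Real.exp ((k : ℝ) * ℓℓ) := h1
    _ ≤ Real.exp (η * ℓ) := Real.exp_le_exp.mpr hkey
    _ = (N : ℝ) ^ η := h2.symm
    _ ≤ (2 * (L : ℝ) * N) ^ η := Real.rpow_le_rpow hN0.le (by nlinarith) hη0.le

/-- Eventually `⌊(2LN)^{1-2ε}⌋ ≤ ⌊N^{1-ε}⌋`, `ε = (log N)^{-1/c}` (`L ≥ 1`, `c ≥ 2`): the kernel's level `x^{1-η}`,
`η = 2ε`, is below the atom's level. As `GeThreeHypAux.eventually_level_le` this reduces to `log 2L ≤ εℓ`, i.e.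
`log 2L · ℓ^{1/c} ≤ ℓ`, which holds once `log 2L ≤ ℓ^{1/2}` (`ℓ^{1/c} ≤ ℓ^{1/2}`). -/
theorem eventually_levelGS_le (L c : ℕ) (hL : 1 ≤ L) (hc : 2 ≤ c) :
    ∀ᶠ N : ℕ in atTop, ⌊(2 * (L : ℝ) * N) ^ (1 - 2 / Real.log (N : ℝ) ^ (1 / (c : ℝ)))⌋₊ ≤
      ⌊(N : ℝ) ^ (1 - 1 / Real.log (N : ℝ) ^ (1 / (c : ℝ)))⌋₊ := by
  have hL1 : (1 : ℝ) ≤ L := by exact_mod_cast hL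
  have hlog2L : 0 ≤ Real.log (2 * (L : ℝ)) := Real.log_nonneg (by linarith)
  obtain ⟨N₁, hN₁⟩ := WalshStepSavAux.exists_thresholds (show (0 : ℝ) < 1 / 2 by norm_num)
    (show (0 : ℝ) < 1 / 2 by norm_num) 0 (Real.log (2 * (L : ℝ)))
  filter_upwards [eventually_ge_atTop N₁, eventually_ge_atTop 1] with N hNN₁ hN1
  obtain ⟨hℓ1, -, hk⟩ := hN₁ N hNN₁
  have hN0 : (0 : ℝ) < N := by exact_mod_cast (by omega : 0 < N)
  set ℓ := Real.log (N : ℝ) with hℓ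
  have hℓ0 : 0 < ℓ := by linarith
  have hpow0 : 0 < ℓ ^ (1 / (c : ℝ)) := Real.rpow_pos_of_pos hℓ0 _
  have hpow1 : 1 ≤ ℓ ^ (1 / (c : ℝ)) := Real.one_le_rpow hℓ1.le (by positivity)
  set ε : ℝ := 1 / ℓ ^ (1 / (c : ℝ)) with hε
  have hε0 : 0 < ε := by rw [hε]; positivity
  have hε1 : ε ≤ 1 := by rw [hε, div_le_one hpow0]; exact hpow1
  have h2ε : 2 / ℓ ^ (1 / (c : ℝ)) = 2 * ε := by rw [hε]; ring
  rw [h2ε]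
  refine Nat.floor_le_floor ?_
  have hx0 : 0 < 2 * (L : ℝ) * N := by positivity
  rw [Real.rpow_def_of_pos hx0, Real.rpow_def_of_pos hN0, Real.exp_le_exp, Real.log_mul (by positivity) hN0.ne',
    ← hℓ]
  -- `(1-2ε)(log 2L + ℓ) ≤ (1-ε) ℓ` iff `(1-2ε) log 2L ≤ ε ℓ`; and `log 2L · ℓ^{1/c} ≤ ℓ` gives `log 2L ≤ ε ℓ`
  have hkey : Real.log (2 * (L : ℝ)) ≤ ε * ℓ := by
    rw [hε, div_mul_eq_mul_div, le_div_iff₀ hpow0, one_mul]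
    have hB : ℓ ^ (1 / (c : ℝ)) ≤ ℓ ^ (1 / 2 : ℝ) := rpow_inv_le_sqrt hℓ1.le hc
    calc Real.log (2 * (L : ℝ)) * ℓ ^ (1 / (c : ℝ)) ≤ ℓ ^ (1 / 2 : ℝ) * ℓ ^ (1 / 2 : ℝ) :=
          mul_le_mul hk hB hpow0.le (Real.rpow_nonneg hℓ0.le _)
      _ = ℓ := by
          rw [← Real.rpow_add hℓ0]
          norm_num
  nlinarith [mul_nonneg hε0.le hlog2L]

end HypGSAux

open HypAlongAux GeThreeHypAux PrLawTwoAssemblyAux HypGSAux in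
/-- **`stub_hypGS`** (registered stub of the Variant-B skeleton, line `superpoly-band-same-atom`): the kernel's
hypotheses for the localised section sequence along the schedule with the Granville–Soundararajan-adjacent deficit
`η = 2(log N)^{-1/c}`, `HypGS` — the landed `stub_hypAlong` with the four `η`-dependent range/level facts redone
(`HypGSAux`) and the atom `SectionLevelGSAt c t` applied at `u := U(N)`. -/
theorem stub_hypGS : HypGS := by
  intro hF hC hD hDl c hc hA t ht L A
  -- the vacuous case `L = 0` (a non-degenerate system has size `≥ 1`)
  rcases Nat.eq_zero_or_pos L with hL0 | hLpos
  · refine ⟨0, 0, fun N _ Ψ hΨ hL K _ _ i => ?_⟩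
    have h1 : (1 : ℝ) ≤ (L : ℝ) := one_le_of_affLinSize_le Ψ hΨ hL i
    rw [hL0, Nat.cast_zero] at h1
    exact absurd h1 (by norm_num)
  have hL1 : 1 ≤ L := hLpos
  have hL1r : (1 : ℝ) ≤ L := by exact_mod_cast hL1
  -- constants
  obtain ⟨L', hL'⟩ := hD t
  obtain ⟨L₁, N₁, hDl'⟩ := hDl t L
  set L'' : ℝ := max L' L₁ with hL''
  obtain ⟨NA, hAt⟩ := hA t ht L A
  obtain ⟨-, -, -, hVal, -⟩ := stub_prLawTwoPrep
  -- all thresholds at once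
  obtain ⟨N₀, hN₀⟩ := Filter.eventually_atTop.1 ((eventually_range_z_lower_along L).and
    ((eventually_range_etaGS_lower L c hL1 hc).and ((eventually_range_etaGS_upper_along c (by omega)).and
    ((eventually_logpow_le_xpow_etaGS L c (t + 2) hL1 hc).and ((eventually_logpow_le_xpow_etaGS L c 2 hL1 hc).and
    ((eventually_size_lower_along L t hL1).and ((eventually_levelGS_le L c hL1 hc).and
    ((eventually_sqrt_loglog_along L hL1).and
    (((Real.tendsto_log_atTop.comp tendsto_natCast_atTop_atTop).eventually_ge_atTop (2 : ℝ)).and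
    ((eventually_ge_atTop NA).and ((eventually_ge_atTop N₁).and (eventually_ge_atTop 1))))))))))))
  refine ⟨L'', N₀, fun N hN Ψ hΨ hL K hK hKN i j' hj' hlt1 hKT hF0 => ?_⟩
  obtain ⟨hz1, hη1, hη2, hΛ, hw, hsz, hlev, hsqrt, hlog2, hNA, hNN₁, hNone⟩ := hN₀ N hN
  have hNpos : 0 < N := hNone
  have hN0 : (0 : ℝ) < N := by exact_mod_cast hNpos
  have hlog2' : (2 : ℝ) ≤ Real.log (N : ℝ) := hlog2
  have hcoeff : (Ψ i).coeff ≠ 0 := hΨ.1 i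
  have h2U : 2 ≤ slowDegree N := le_trans (by norm_num) (four_le_slowDegree N)
  -- the facts about the section sequence at the scheduled roughness
  obtain ⟨hsize, -, hrem, hsizeF, hdens, hconvle, -⟩ := hF t Ψ K N (slowDegree N) i j'
  obtain ⟨hwt, hsuppHi, hsuppLo, hcells, -, -⟩ := hC t Ψ K N (slowDegree N) i j'
  have hvals : ∀ n ∈ latticeBox 1 N, (((Ψ i).eval n : ℤ) : ℝ) ≤ xOf L N := fun n hn =>
    hVal (t + 1) Ψ N L hNpos hL i n hn
  obtain ⟨hdensLe, hlow⟩ := hDl' N hNN₁ Ψ hΨ hL i hlt1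
  simp only [xOf, zOf, etaGS, lamOf, wOf, rOf] at hKT hvals ⊢
  refine ⟨⟨hsqrt, hz1, range_z_upper hL1 N (slowDegree N), hη1, hη2, one_le_pow₀ (by linarith), hΛ, ?_, hw⟩,
    hwt hcoeff, fun q hq => hsuppHi _ q hvals hq, fun q hq => hsuppLo _ q hKT hq, hsize, ?_, ?_,
    hasIwaniecDimension_mono (hL' Ψ i hlt1) (le_max_left _ _), ?_, ?_,
    fun m hm => hcells _ hvals m hm, hsizeF _ hvals, hdens _⟩
  · -- `2 ≤ (log N)²`
    nlinarith
  · -- size from below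
    rw [hsizeF _ hvals]
    exact hsz.trans hF0
  · -- `g(p) ≤ (t+2)/p`
    intro p hp
    change sectionDensityFn Ψ i p ≤ _
    rw [sectionDensityFn_apply Ψ i hp.ne_zero]
    exact hdensLe p hp
  · -- the Mertens product from below above `w₀`, with `L'' ≥ L₁`
    intro w z' hw0 hwz hz'x
    have hlogw : 0 < Real.log w := Real.log_pos (by nlinarith)
    have hlogz' : 0 ≤ Real.log z' := Real.log_nonneg (by nlinarith)
    have hprod : ∏ p ∈ (Nat.primesBelow ⌈z'⌉₊).filter (fun p : ℕ => w ≤ (p : ℝ)),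
        (1 - (secSeqB Ψ K N (slowDegree N) i j').density p)⁻¹ =
        ∏ p ∈ (Nat.primesBelow ⌈z'⌉₊).filter (fun p : ℕ => w ≤ (p : ℝ)), (1 - sectionDensity Ψ i p)⁻¹ := by
      refine Finset.prod_congr rfl fun p hp => ?_
      have hp' : p.Prime := Nat.prime_of_mem_primesBelow (Finset.mem_filter.mp hp).1
      change (1 - sectionDensityFn Ψ i p)⁻¹ = _
      rw [sectionDensityFn_apply Ψ i hp'.ne_zero]
    rw [hprod]
    refine le_trans ?_ (hlow w z' hw0 hwz hz'x)
    have h0 : 0 ≤ Real.log z' / Real.log w := div_nonneg hlogz' hlogw.le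
    apply mul_le_mul_of_nonneg_left _ h0
    have : L₁ / Real.log w ≤ L'' / Real.log w :=
      div_le_div_of_nonneg_right (le_max_right _ _) hlogw.le
    linarith
  · -- Type-I for every truncation `y ≤ x`: the Variant-B atom, at `u := U(N)`, on `K ∩ {ψ_i ≤ y}`
    intro y _hy
    set Ky : Set (Fin 1 → ℝ) := K ∩ {v | (Ψ i).realEval v ≤ y} with hKy
    have hKyconv : Convex ℝ Ky := hconvle y hK
    have hKysub : Ky ⊆ realBox 1 N := Set.inter_subset_left.trans hKN
    have hAtN := hAt N hNA (slowDegree N) h2U le_rfl Ψ hΨ hL Ky hKyconv hKysub i j' hj'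
    have hterm : ∀ d ∈ (Finset.Icc 1 ⌊(2 * (L : ℝ) * N) ^ (1 - 2 / Real.log (N : ℝ) ^ (1 / (c : ℝ)))⌋₊).filter
        Squarefree, |(secSeqB Ψ K N (slowDegree N) i j').remainder d y| =
          |(sectionMass Ψ Ky N (slowDegree N) i j' d : ℝ) -
            sectionDensity Ψ i d * (sectionMass Ψ Ky N (slowDegree N) i j' 1 : ℝ)| := by
      intro d hd
      have hd1 : 1 ≤ d := (Finset.mem_Icc.mp (Finset.mem_filter.mp hd).1).1
      rw [hrem d y (by omega)]
    rw [Finset.sum_congr rfl hterm]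
    refine le_trans (Finset.sum_le_sum_of_subset_of_nonneg ?_ fun _ _ _ => abs_nonneg _) hAtN
    intro d hd
    obtain ⟨hdI, hdsq⟩ := Finset.mem_filter.mp hd
    obtain ⟨hd1, hdle⟩ := Finset.mem_Icc.mp hdI
    exact Finset.mem_filter.mpr ⟨Finset.mem_Icc.mpr ⟨hd1, hdle.trans hlev⟩, hdsq⟩

end Summit.Parity.GeneralizedHardyLittlewood.Cruxes.CellParityLawSaving.SuperPolyBand

end
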